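import Mathlib
import Literature.MathematicalPhysics.QuantumFieldTheory.Balaban1983to89.B13Ineq232TreeLength

/-!
# `Balaban1983to89.B13Ineq232Star` — the printed (2.32) of [Balaban1988RG2Cluster] p. 18 is FALSE with the constant 4
for the formalised tree length `TreeLength.treeLen` of [Balaban1987RG1] p. 257: a kernel-checked counterexample

T. Bałaban, *Renormalization group approach to lattice gauge field theories. II. Cluster expansions*, Commun. Math.
Phys. **116**, 1–22 (1988), doi:10.1007/bf01239022 [Balaban1988RG2Cluster] (cell paper B13; PDF held
`paper:balaban1988-cmp116-rg-ii-cluster`, journal page = PDF page), p. 18 (2.32), verbatim: *"By a simple geometric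
argument we have Σ_i d_k(Y_i) + 4M⁻⁴|Z₀∖Y₀| ≧ d_k(Z₀)"* (Z₀ one of the connected components, Y_i the components of
Y₀ contained in it) — typed in `…B13Ineq232` as `Ineq232Printed D tl` on the geometric datum `D : CompData d`
(ℤ^d index model of `…B13ScaleTransfer`), for an abstract length `tl`.

WHAT THIS MODULE PROVES (sibling of `…B13Ineq232`, `…B13Ineq232TreeLength`, `…TreeLength`; nothing in them is
modified).  For the length notion d_k FORMALISED in `…TreeLength` — `treeLen X` = the infimum of the sup-metric
lengths of the connected polygonal graphs contained in the union of the closed unit cubes of X and meeting every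
such cube ([Balaban1987RG1] p. 257, conventions (i)–(iii) of that module) — the printed inequality (2.32) FAILS on an
explicit datum, the "star" of the cell's gap report (cell GAPS.md G-B13-08, M = 1): the centre cube 0 ∈ ℤ^d together
with the 2d two-cube arms {±e_μ, ±2e_μ}; here Z₀ = star, the Y_i are the 2d arms (pairwise disjoint and pairwise
without common walls, so they are admissible as the components of Y₀), Z₀ ∖ Y₀ = {0}, M⁻⁴|Z₀∖Y₀| = 1.
 * `treeLen_pair_of_adj` — two cubes with a common wall have linear size 0 (the one-point graph at a point of the
   common wall meets both CLOSED cubes); hence Σ_i d_k(Y_i) = 0 on the star (`sum_parts_star`).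
 * `le_len_admissible_star`, `two_d_le_treeLen_star` — every admissible graph for the star has length ≥ 2d(1 − η)
   for every η ∈ (0, 1), hence d_k(star) ≥ 2d: around a point of the graph in each of the 2d tip cubes ±2e_μ the
   closed sup-ball of radius 1 − η captures length ≥ 1 − η of the graph (the CAPTURE LEMMA `le_lenIn_closedBall` of
   `…TreeLength` Part 6, since the graph also meets the centre cube, at sup-distance ≥ 1), and the 2d captured
   pieces lie in pairwise disjoint closed regions (ball ∩ the union of the cubes of the star: a point of the star's
   cubes beyond the wall of a tip arm has all its other coordinates in [0, 1]), so they add up (`sum_lenIn_le_len`,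
   `…TreeLength` Part 5).
 * `not_ineq232Printed_star` — for d ≥ 3 the printed (2.32) is false on the star: d_k(Z₀) ≥ 2d > 4 =
   Σ_i d_k(Y_i) + 4M⁻⁴|Z₀∖Y₀|; `not_ineq232Printed_star_four` — the case d = 4 of the paper (8 > 4), which is the
   cell's located objection G-B13-08 ("m = 2: claim d_k(Z₀) ≤ 4, truth ≥ 8") as a kernel theorem.
 * `treeLen_star_le` — on the same datum the (2.32)-SUBSTITUTE `ineq232_treeLen` of `…B13Ineq232TreeLength`
   (constant 1 + 4d in place of 4; d = 4: 17) gives d_k(star) ≤ 1 + 4d, as it must.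

SCOPE (candid).  Refuted is the inequality AS PRINTED, for the length AS FORMALISED (sup metric of
[Dimock2013BalabanII] App. E; connected polygonal graphs; closed cubes, so that a graph may meet two adjacent cubes
at one wall point).  Under the other natural conventions the same star still violates the constant 4 (informal
remark, not formalised here: with trees through the cube CENTRES an arm of m cubes has length m − 1 and the star
with arms of m cubes has d_k = 2d·m against the printed bound 2d(m − 1) + 4; in the Euclidean metric all lengths
on the star's axes are unchanged).  Whether the localization domains of [Balaban1988RG2Cluster] §1 (unions of big
blocks) can realise this datum depends on shape constraints not printed there (cell GAPS.md G-B13-08, last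
sentence); the substitute `ineq232_treeLen` holds for every datum regardless.  Value: kernel-checked refutation of
one printed constant in a located gap of the manuscript under audit, with the repaired statement already landed —
bookkeeping, NOT summit progress.
-/

noncomputable section

namespace Literature.MathematicalPhysics.QuantumFieldTheory.Balaban1983to89.B13Ineq232Star

open Literature.MathematicalPhysics.QuantumFieldTheory.Balaban1983to89
open Literature.MathematicalPhysics.QuantumFieldTheory.Balaban1983to89.B13ScaleTransfer
open Literature.MathematicalPhysics.QuantumFieldTheory.Balaban1983to89.B13Ineq232
open Literature.MathematicalPhysics.QuantumFieldTheory.Balaban1983to89.TreeLength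
open Literature.MathematicalPhysics.QuantumFieldTheory.Balaban1983to89.B13Ineq232TreeLength
open MeasureTheory

variable {d : ℕ}

/-! ## Part 1. Two general facts about the formalised length -/

/-- Monotonicity of the length inside a region: if every point of the graph lying in B lies in B′, the length of the
graph inside B is at most its length inside B′. [folklore] -/
theorem lenIn_mono {B B' : Set (RPt d)} :
    ∀ T : List (Seg d), (∀ z ∈ carrier T, z ∈ B → z ∈ B') → lenIn B T ≤ lenIn B' T
  | [], _ => by simp
  | s :: T, h => by
    rw [lenIn_cons, lenIn_cons]
    have hT : lenIn B T ≤ lenIn B' T :=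
      lenIn_mono T fun z hz hzB => h z (by rw [carrier_cons]; exact Or.inr hz) hzB
    have hsub : paramIn B s ⊆ paramIn B' s := by
      intro t ht
      refine ⟨ht.1, ?_⟩
      have hmem : gam s t ∈ carrier (s :: T) := by
        rw [carrier_cons]
        left
        rw [segment_eq_image_gam]
        exact ⟨t, ht.1, rfl⟩
      exact h _ hmem ht.2
    have hv : (volume (paramIn B s)).toReal ≤ (volume (paramIn B' s)).toReal :=
      ENNReal.toReal_mono (volume_paramIn_ne_top B' s) (measure_mono hsub)
    have hm : dist s.1 s.2 * (volume (paramIn B s)).toReal ≤ dist s.1 s.2 * (volume (paramIn B' s)).toReal :=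
      mul_le_mul_of_nonneg_left hv dist_nonneg
    linarith

/-- Two cubes with a common wall have linear size 0: the one-point graph at a point of the common wall (the wall
point of `exists_wall_point`, [Dimock2013] Lemma 20 mechanism) is contained in and meets both CLOSED cubes
([Balaban1987RG1] p. 257: *"graphs contained in X and intersecting all the cubes in X"*). [cite: Balaban1987RG1, p.257 (linear size d_j)] -/
theorem treeLen_pair_of_adj {a b : Pt d} (h : Adj a b) : treeLen ({a, b} : Finset (Pt d)) = 0 := by
  obtain ⟨q, hqa, hqb, -⟩ := exists_wall_point h (corner_mem_cube a)
  have hadm : Admissible ({a, b} : Finset (Pt d)) [(q, q)] := by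
    refine ⟨?_, ?_, ?_⟩
    · simp only [carrier_cons, carrier_nil, Set.union_empty, segment_same]
      exact isConnected_singleton
    · simp only [carrier_cons, carrier_nil, Set.union_empty, segment_same, Set.singleton_subset_iff]
      exact mem_cubes.2 ⟨a, by simp, hqa⟩
    · intro x hx
      simp only [Finset.mem_insert, Finset.mem_singleton] at hx
      refine ⟨q, by simp, ?_⟩
      rcases hx with rfl | rfl
      · exact hqa
      · exact hqb
  have h1 : treeLen ({a, b} : Finset (Pt d)) ≤ 0 := by simpa using treeLen_le_len hadm
  exact le_antisymm h1 (treeLen_nonneg _)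

/-- The union of the closed cubes of a finite index set is closed. [folklore] -/
theorem isClosed_cubes (X : Finset (Pt d)) : IsClosed (cubes X) :=
  isClosed_biUnion_finset fun x _ => by
    show IsClosed (Set.Icc _ _)
    exact isClosed_Icc

/-! ## Part 2. The star: the centre cube 0 and the 2d arms {±e_μ, ±2e_μ} (cell GAPS.md G-B13-08, m = 2) -/

/-- The code of an arm: a coordinate direction μ and a sign. [folklore] -/
abbrev Code (d : ℕ) := Fin d × Bool

/-- The sign ±1 of an arm. [folklore] -/
def sgn (p : Code d) : ℤ := if p.2 then 1 else -1

/-- The near cube ±e_μ of the arm. [folklore] -/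
def near (p : Code d) : Pt d := fun μ => if μ = p.1 then sgn p else 0

/-- The tip cube ±2e_μ of the arm. [folklore] -/
def far (p : Code d) : Pt d := fun μ => if μ = p.1 then 2 * sgn p else 0

/-- The arm Y_{±μ} = {±e_μ, ±2e_μ} (a straight row of m = 2 cubes). [folklore] -/
def arm (p : Code d) : Finset (Pt d) := {near p, far p}

/-- The 2d arms, i.e. the components Y_i of Y₀. [folklore] -/
def arms : Finset (Finset (Pt d)) := Finset.univ.image (arm (d := d))

/-- The star Z₀ = {0} ∪ ⋃ arms. [folklore] -/
def Zstar : Finset (Pt d) := insert 0 ((arms (d := d)).biUnion id)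

/-- The sign of an arm is 1 or −1. [folklore] -/
theorem sgn_cases (p : Code d) : sgn p = 1 ∨ sgn p = -1 := by
  unfold sgn
  split_ifs <;> simp

/-- Membership in an arm. [folklore] -/
theorem mem_arm {p : Code d} {x : Pt d} : x ∈ arm p ↔ x = near p ∨ x = far p := by
  simp [arm]

/-- Membership in the family of arms. [folklore] -/
theorem mem_arms {P : Finset (Pt d)} : P ∈ (arms (d := d)) ↔ ∃ p : Code d, P = arm p := by
  simp [arms, eq_comm]

/-- Membership in the star. [folklore] -/
theorem mem_Zstar {x : Pt d} : x ∈ (Zstar (d := d)) ↔ x = 0 ∨ ∃ p : Code d, x ∈ arm p := by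
  constructor
  · intro h
    rw [Zstar, Finset.mem_insert, Finset.mem_biUnion] at h
    rcases h with h | ⟨P, hP, hx⟩
    · exact Or.inl h
    · obtain ⟨p, rfl⟩ := mem_arms.1 hP
      exact Or.inr ⟨p, hx⟩
  · rintro (h | ⟨p, hx⟩)
    · rw [h]
      exact Finset.mem_insert_self _ _
    · exact Finset.mem_insert_of_mem (Finset.mem_biUnion.2 ⟨arm p, mem_arms.2 ⟨p, rfl⟩, hx⟩)

/-- The centre cube belongs to the star. [folklore] -/
theorem zero_mem_Zstar : (0 : Pt d) ∈ (Zstar (d := d)) := mem_Zstar.2 (Or.inl rfl)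

/-- The near cube of an arm belongs to the arm. [folklore] -/
theorem near_mem_arm (p : Code d) : near p ∈ arm p := mem_arm.2 (Or.inl rfl)

/-- The tip cube of an arm belongs to the arm. [folklore] -/
theorem far_mem_arm (p : Code d) : far p ∈ arm p := mem_arm.2 (Or.inr rfl)

/-- The arms lie in the star. [folklore] -/
theorem arm_subset_Zstar (p : Code d) : arm p ⊆ (Zstar (d := d)) :=
  fun _ hx => mem_Zstar.2 (Or.inr ⟨p, hx⟩)

/-- Coordinates of the cubes of an arm: zero off the axis, ±1 or ±2 on the axis. [folklore] -/
theorem coord_of_mem_arm {p : Code d} {x : Pt d} (hx : x ∈ arm p) :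
    (∀ μ, μ ≠ p.1 → x μ = 0) ∧ (x p.1 = sgn p ∨ x p.1 = 2 * sgn p) := by
  rcases mem_arm.1 hx with rfl | rfl
  · exact ⟨fun μ hμ => by simp [near, hμ], Or.inl (by simp [near])⟩
  · exact ⟨fun μ hμ => by simp [far, hμ], Or.inr (by simp [far])⟩

/-- The centre cube is not in any arm. [folklore] -/
theorem zero_not_mem_arm (p : Code d) : (0 : Pt d) ∉ arm p := by
  intro h
  obtain ⟨-, h1⟩ := coord_of_mem_arm h
  simp only [Pi.zero_apply] at h1
  rcases sgn_cases p with hs | hs <;> rcases h1 with h1 | h1 <;> omega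

/-- Opposite signs. [folklore] -/
theorem sgn_eq_neg_of_ne {p q : Code d} (h : p.2 ≠ q.2) : sgn p = -sgn q := by
  unfold sgn
  rcases Bool.eq_false_or_eq_true p.2 with hp | hp <;>
    rcases Bool.eq_false_or_eq_true q.2 with hq | hq <;> simp_all

/-- Distinct arms are disjoint: a cube lies in at most one arm. [folklore] -/
theorem eq_of_mem_arm {p q : Code d} {x : Pt d} (hp : x ∈ arm p) (hq : x ∈ arm q) : p = q := by
  obtain ⟨hp0, hp1⟩ := coord_of_mem_arm hp
  obtain ⟨hq0, hq1⟩ := coord_of_mem_arm hq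
  have h1 : p.1 = q.1 := by
    by_contra hne
    have h0 : x p.1 = 0 := hq0 p.1 hne
    rcases sgn_cases p with hs | hs <;> rcases hp1 with h' | h' <;> omega
  have h2 : p.2 = q.2 := by
    by_contra hne
    have hs := sgn_eq_neg_of_ne hne
    rw [h1] at hp1
    rcases sgn_cases q with h | h <;> rcases hp1 with h' | h' <;> rcases hq1 with h'' | h'' <;> omega
  exact Prod.ext h1 h2

/-- Distinct arms have no common wall: if a cube of one arm and a cube of another differ by +e_i, the arms coincide.
[folklore] -/
theorem eq_of_update_mem_arm {p q : Code d} {a b : Pt d} (ha : a ∈ arm p) (hb : b ∈ arm q) (i : Fin d)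
    (h : b = Function.update a i (a i + 1)) : p = q := by
  obtain ⟨ha0, ha1⟩ := coord_of_mem_arm ha
  obtain ⟨hb0, hb1⟩ := coord_of_mem_arm hb
  have hbi : b i = a i + 1 := by rw [h, Function.update_self]
  have hbμ : ∀ μ, μ ≠ i → b μ = a μ := fun μ hμ => by rw [h, Function.update_of_ne hμ]
  have hbq : b q.1 ≠ 0 := by rcases sgn_cases q with hs | hs <;> rcases hb1 with h' | h' <;> omega
  have h1 : p.1 = q.1 := by
    by_contra hne
    have hbp : b p.1 = 0 := hb0 p.1 hne
    by_cases hpi : p.1 = i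
    · have hqi : q.1 ≠ i := fun h' => hne (hpi.trans h'.symm)
      have e1 : b q.1 = a q.1 := hbμ q.1 hqi
      have e2 : a q.1 = 0 := ha0 q.1 (Ne.symm hne)
      exact hbq (by rw [e1, e2])
    · have e1 : b p.1 = a p.1 := hbμ p.1 hpi
      rcases sgn_cases p with hs | hs <;> rcases ha1 with h' | h' <;> omega
  have h2 : p.2 = q.2 := by
    by_contra hne
    have hs := sgn_eq_neg_of_ne hne
    by_cases hpi : p.1 = i
    · have hb' : b p.1 = a p.1 + 1 := by rw [hpi]; exact hbi
      rw [← h1] at hb1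
      rcases sgn_cases p with h0 | h0 <;> rcases ha1 with h' | h' <;> rcases hb1 with h'' | h'' <;> omega
    · have hai : a i = 0 := ha0 i (Ne.symm hpi)
      have hbi0 : b i = 0 := hb0 i (by rw [← h1]; exact Ne.symm hpi)
      omega
  exact Prod.ext h1 h2

/-- The near cube ±e_μ has a common wall with the centre cube. [folklore] -/
theorem adj_zero_near (p : Code d) : Adj (0 : Pt d) (near p) := by
  obtain ⟨i, b⟩ := p
  cases b
  · refine ⟨i, Or.inr ?_⟩
    funext μ
    by_cases hμ : μ = i
    · subst hμ
      simp [near, sgn]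
    · simp [near, hμ]
  · refine ⟨i, Or.inl ?_⟩
    funext μ
    by_cases hμ : μ = i
    · subst hμ
      simp [near, sgn]
    · simp [near, hμ]

/-- The tip cube ±2e_μ has a common wall with the near cube ±e_μ. [folklore] -/
theorem adj_near_far (p : Code d) : Adj (near p) (far p) := by
  obtain ⟨i, b⟩ := p
  cases b
  · refine ⟨i, Or.inr ?_⟩
    funext μ
    by_cases hμ : μ = i
    · subst hμ
      simp [near, far, sgn]
    · simp [near, far, hμ]
  · refine ⟨i, Or.inl ?_⟩
    funext μ
    by_cases hμ : μ = i
    · subst hμ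
      simp [near, far, sgn]
    · simp [near, far, hμ]

/-- Every cube of the star is chain-connected to the centre cube inside the star. [folklore] -/
theorem linked_zero {x : Pt d} (hx : x ∈ (Zstar (d := d))) : Linked Zstar 0 x := by
  rcases mem_Zstar.1 hx with rfl | ⟨p, hxp⟩
  · exact linked_refl _ _
  have hn : near p ∈ (Zstar (d := d)) := arm_subset_Zstar p (near_mem_arm p)
  have hf : far p ∈ (Zstar (d := d)) := arm_subset_Zstar p (far_mem_arm p)
  have h1 : Linked Zstar 0 (near p) := linked_of_stepIn ⟨zero_mem_Zstar, hn, adj_zero_near p⟩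
  rcases mem_arm.1 hxp with rfl | rfl
  · exact h1
  · exact h1.trans (linked_of_stepIn ⟨hn, hf, adj_near_far p⟩)

/-- The star is a connected family of cubes. [folklore] -/
theorem faceConnected_Zstar : FaceConnected (Zstar (d := d)) :=
  fun _ hx _ hy => (linked_zero hx).symm.trans (linked_zero hy)

/-- THE STAR DATUM of (2.32): Z₀ = the star, parts = the 2d arms (each a non-empty connected family inside Z₀;
pairwise disjoint; pairwise without common walls — *"cubes e₁ and e₂ share only a 2-face"*, cell GAPS.md G-B13-08).
[cite: Balaban1988RG2Cluster, (2.32) p.18] -/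
def star : CompData d where
  Z₀ := Zstar
  parts := arms
  hZ := faceConnected_Zstar
  sub := fun P hP => by
    obtain ⟨p, rfl⟩ := mem_arms.1 hP
    exact arm_subset_Zstar p
  ne := fun P hP => by
    obtain ⟨p, rfl⟩ := mem_arms.1 hP
    exact ⟨near p, near_mem_arm p⟩
  conn := fun P hP => by
    obtain ⟨p, rfl⟩ := mem_arms.1 hP
    exact faceConnected_pair (adj_near_far p)
  disj := fun P hP Q hQ hne => by
    obtain ⟨p, rfl⟩ := mem_arms.1 hP
    obtain ⟨q, rfl⟩ := mem_arms.1 hQ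
    exact Finset.disjoint_left.2 fun x hxp hxq => hne (by rw [eq_of_mem_arm hxp hxq])
  sep := fun P hP Q hQ hne x hx y hy hadj => by
    obtain ⟨p, rfl⟩ := mem_arms.1 hP
    obtain ⟨q, rfl⟩ := mem_arms.1 hQ
    obtain ⟨i, h | h⟩ := hadj
    · exact hne (by rw [eq_of_update_mem_arm hx hy i h])
    · exact hne (by rw [eq_of_update_mem_arm hy hx i h])

/-- The Z₀ of the star datum is the star. [folklore] -/
theorem star_Z₀ : (star : CompData d).Z₀ = Zstar := rfl

/-- The parts of the star datum are the arms. [folklore] -/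
theorem star_parts : (star : CompData d).parts = arms := rfl

/-- Z₀ ∖ Y₀ = {0}: the centre cube is the only extra cube. [folklore] -/
theorem W_star : (star : CompData d).W = {0} := by
  ext x
  rw [CompData.mem_W, Finset.mem_singleton, star_Z₀]
  constructor
  · rintro ⟨hx, hx'⟩
    rcases mem_Zstar.1 hx with h | ⟨p, hp⟩
    · exact h
    · exact absurd ((CompData.mem_Y₀ _).2 ⟨arm p, mem_arms.2 ⟨p, rfl⟩, hp⟩) hx'
  · rintro rfl
    refine ⟨zero_mem_Zstar, fun h => ?_⟩
    obtain ⟨P, hP, h0⟩ := (CompData.mem_Y₀ _).1 h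
    obtain ⟨p, rfl⟩ := mem_arms.1 hP
    exact zero_not_mem_arm p h0

/-- M⁻⁴|Z₀ ∖ Y₀| = 1 on the star. [folklore] -/
theorem card_W_star : (star : CompData d).W.card = 1 := by
  rw [W_star, Finset.card_singleton]

/-- Σ_i d_k(Y_i) = 0 on the star: each arm is a pair of cubes with a common wall. [folklore] -/
theorem sum_parts_star : ∑ P ∈ (star : CompData d).parts, treeLen P = 0 := by
  refine Finset.sum_eq_zero fun P hP => ?_
  obtain ⟨p, rfl⟩ := mem_arms.1 hP
  unfold arm
  exact treeLen_pair_of_adj (adj_near_far p)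

/-! ## Part 3. The lower bound d_k(star) ≥ 2d by capture in 2d disjoint regions -/

/-- Beyond the wall of the arm: coordinate μ of the point is > 1 (positive arm) or < 0 (negative arm). [folklore] -/
def FarSide (p : Code d) (z : RPt d) : Prop := (p.2 = true ∧ 1 < z p.1) ∨ (p.2 = false ∧ z p.1 < 0)

/-- The axis coordinate of the tip cube, as a real number: 2 or −2. [folklore] -/
theorem far_axis_cast (p : Code d) :
    (p.2 = true ∧ ((far p p.1 : ℤ) : ℝ) = 2) ∨ (p.2 = false ∧ ((far p p.1 : ℤ) : ℝ) = -2) := by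
  rcases Bool.eq_false_or_eq_true p.2 with h | h
  · left
    exact ⟨h, by simp [far, sgn, h]⟩
  · right
    refine ⟨h, ?_⟩
    simp [far, sgn, h]

/-- A point of a tip cube and a point of the centre cube are at sup-distance ≥ 1. [folklore] -/
theorem one_le_dist_of_mem_far {p : Code d} {P q : RPt d} (hP : P ∈ cube (far p)) (hq : q ∈ cube (0 : Pt d)) :
    1 ≤ dist P q := by
  have hPi := (mem_cube.1 hP) p.1
  have hqi := (mem_cube.1 hq) p.1
  simp only [Pi.zero_apply, Int.cast_zero, zero_add] at hqi
  have habs : 1 ≤ |P p.1 - q p.1| := by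
    rcases far_axis_cast p with ⟨-, h⟩ | ⟨-, h⟩ <;> rw [h] at hPi
    · exact le_abs.2 (Or.inl (by linarith [hPi.1, hqi.2]))
    · exact le_abs.2 (Or.inr (by linarith [hPi.2, hqi.1]))
  calc (1 : ℝ) ≤ |P p.1 - q p.1| := habs
    _ = dist (P p.1) (q p.1) := (Real.dist_eq _ _).symm
    _ ≤ dist P q := dist_le_pi_dist P q p.1

/-- The closed sup-ball of radius 1 − η (η > 0) around a point of a tip cube lies beyond the wall of that arm.
[folklore] -/
theorem farSide_of_mem_closedBall {p : Code d} {P z : RPt d} (hP : P ∈ cube (far p)) {η : ℝ} (hη : 0 < η)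
    (hz : z ∈ Metric.closedBall P (1 - η)) : FarSide p z := by
  have hPi := (mem_cube.1 hP) p.1
  have hzi : |z p.1 - P p.1| ≤ 1 - η := by
    rw [← Real.dist_eq]
    exact (dist_le_pi_dist z P p.1).trans (Metric.mem_closedBall.1 hz)
  obtain ⟨h1, h2⟩ := abs_le.1 hzi
  rcases far_axis_cast p with ⟨hb, h⟩ | ⟨hb, h⟩ <;> rw [h] at hPi
  · exact Or.inl ⟨hb, by linarith [hPi.1]⟩
  · exact Or.inr ⟨hb, by linarith [hPi.2]⟩

/-- A point of the star's cubes lying beyond the wall of an arm has all its other coordinates in [0, 1] (it lies in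
a cube of that arm's axis). [folklore] -/
theorem slab_of_farSide {p : Code d} {z : RPt d} (hz : z ∈ cubes (Zstar (d := d))) (hf : FarSide p z) :
    ∀ μ, μ ≠ p.1 → 0 ≤ z μ ∧ z μ ≤ 1 := by
  obtain ⟨x, hx, hzx⟩ := mem_cubes.1 hz
  have hc := mem_cube.1 hzx
  -- the cube x containing z has x_{p.1} ≠ 0
  have hxp : x p.1 ≠ 0 := by
    intro h0
    have := hc p.1
    rw [h0, Int.cast_zero, zero_add] at this
    rcases hf with ⟨-, h⟩ | ⟨-, h⟩ <;> linarith [this.1, this.2]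
  rcases mem_Zstar.1 hx with rfl | ⟨q, hxq⟩
  · exact absurd rfl hxp
  obtain ⟨hq0, -⟩ := coord_of_mem_arm hxq
  have hqp : q.1 = p.1 := by
    by_contra hne
    exact hxp (hq0 p.1 (Ne.symm hne))
  intro μ hμ
  have hxμ : x μ = 0 := hq0 μ (by rw [hqp]; exact hμ)
  have := hc μ
  rw [hxμ, Int.cast_zero, zero_add] at this
  exact this

/-- The far sides of two distinct arms do not meet inside the star's cubes. [folklore] -/
theorem farSide_disjoint {p q : Code d} (hpq : p ≠ q) {z : RPt d} (hfp : FarSide p z) (hfq : FarSide q z)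
    (hz : z ∈ cubes (Zstar (d := d))) : False := by
  have hs := slab_of_farSide hz hfp
  by_cases h : q.1 = p.1
  · have h2 : p.2 ≠ q.2 := fun h2 => hpq (Prod.ext h.symm h2)
    rw [FarSide, h] at hfq
    rcases hfp with ⟨hb, h1⟩ | ⟨hb, h1⟩ <;> rcases hfq with ⟨hb', h1'⟩ | ⟨hb', h1'⟩
    · exact h2 (hb.trans hb'.symm)
    · linarith
    · linarith
    · exact h2 (hb.trans hb'.symm)
  · obtain ⟨h0, h1⟩ := hs q.1 h
    rcases hfq with ⟨-, h'⟩ | ⟨-, h'⟩ <;> linarith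

/-- CAPTURE ON THE STAR: for every η ∈ (0, 1), every admissible graph for the star has length ≥ 2d(1 − η) — the 2d
closed sup-balls of radius 1 − η around points of the graph in the tip cubes each capture length ≥ 1 − η
(`le_lenIn_closedBall`), in pairwise disjoint closed regions (`sum_lenIn_le_len`). [folklore] -/
theorem le_len_admissible_star {η : ℝ} (hη : 0 < η) (hη1 : η < 1) {T : List (Seg d)}
    (hT : Admissible (Zstar (d := d)) T) : 2 * (d : ℝ) * (1 - η) ≤ len T := by
  choose P hP using fun p : Code d => hT.meets (far p) (arm_subset_Zstar p (far_mem_arm p))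
  obtain ⟨q₀, hq₀T, hq₀c⟩ := hT.meets 0 zero_mem_Zstar
  set ρ : ℝ := 1 - η with hρdef
  have hρ : 0 < ρ := by rw [hρdef]; linarith
  set B : Code d → Set (RPt d) := fun p => Metric.closedBall (P p) ρ ∩ cubes (Zstar (d := d)) with hBdef
  have hBclosed : ∀ p ∈ (Finset.univ : Finset (Code d)), IsClosed (B p) :=
    fun p _ => Metric.isClosed_closedBall.inter (isClosed_cubes _)
  have hdis : ((Finset.univ : Finset (Code d)) : Set (Code d)).PairwiseDisjoint B := by
    intro p _ q _ hpq
    exact Set.disjoint_left.2 fun z hzp hzq =>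
      farSide_disjoint hpq (farSide_of_mem_closedBall (hP p).2 hη hzp.1)
        (farSide_of_mem_closedBall (hP q).2 hη hzq.1) hzp.2
  have hcap : ∀ p : Code d, ρ ≤ lenIn (B p) T := by
    intro p
    have hdist : ρ ≤ dist (P p) q₀ := by
      have h1 : (1 : ℝ) ≤ dist (P p) q₀ := one_le_dist_of_mem_far (hP p).2 hq₀c
      linarith
    calc ρ ≤ lenIn (Metric.closedBall (P p) ρ) T :=
          le_lenIn_closedBall hT.connected.isPreconnected (hP p).1 hq₀T hρ hdist
      _ ≤ lenIn (B p) T := lenIn_mono T fun z hz hzb => ⟨hzb, hT.subset hz⟩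
  have hsum : ∑ p ∈ (Finset.univ : Finset (Code d)), lenIn (B p) T ≤ len T :=
    sum_lenIn_le_len Finset.univ B hBclosed hdis T
  have hlow : ∑ p ∈ (Finset.univ : Finset (Code d)), ρ ≤ ∑ p ∈ (Finset.univ : Finset (Code d)), lenIn (B p) T :=
    Finset.sum_le_sum fun p _ => hcap p
  have hcard : ∑ p ∈ (Finset.univ : Finset (Code d)), ρ = 2 * (d : ℝ) * ρ := by
    rw [Finset.sum_const, Finset.card_univ, Fintype.card_prod, Fintype.card_fin, Fintype.card_bool, nsmul_eq_mul]
    push_cast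
    ring
  linarith [hsum, hlow, hcard]

/-- LOWER BOUND: d_k(star) ≥ 2d. [folklore] -/
theorem two_d_le_treeLen_star : 2 * (d : ℝ) ≤ treeLen (Zstar (d := d)) := by
  by_contra hlt
  have hlt' : treeLen (Zstar (d := d)) < 2 * (d : ℝ) := not_le.mp hlt
  have ht0 := treeLen_nonneg (Zstar (d := d))
  have hd0 : (0 : ℝ) ≤ d := Nat.cast_nonneg d
  rcases hd0.eq_or_lt with hd | hd
  · rw [← hd] at hlt'
    linarith
  set t := treeLen (Zstar (d := d)) with htdef
  set η : ℝ := (2 * d - t) / (4 * d) with hηdef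
  have h4 : (0 : ℝ) < 4 * d := by linarith
  have hη : 0 < η := div_pos (by linarith) h4
  have hη1 : η < 1 := by
    rw [hηdef, div_lt_one h4]
    linarith
  have hle : 2 * (d : ℝ) * (1 - η) ≤ t :=
    le_treeLen (nonempty_admissible ⟨0, zero_mem_Zstar⟩ faceConnected_Zstar)
      fun T hT => le_len_admissible_star hη hη1 hT
  have hcalc : 2 * (d : ℝ) * (1 - η) = 2 * d - (2 * d - t) / 2 := by
    rw [hηdef]
    field_simp
    ring
  linarith

/-! ## Part 4. The refutation of the printed (2.32), and the substitute on the same datum -/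

/-- THE PRINTED (2.32) IS FALSE WITH THE CONSTANT 4 (d ≥ 3) for the formalised tree length: on the star,
d_k(Z₀) ≥ 2d > 4 = Σ_i d_k(Y_i) + 4M⁻⁴|Z₀∖Y₀| (cell GAPS.md G-B13-08 as a kernel theorem). [cite: Balaban1988RG2Cluster, (2.32) p.18] -/
theorem not_ineq232Printed_star (hd : 3 ≤ d) : ¬ Ineq232Printed (star : CompData d) (treeLen (d := d)) := by
  intro h
  unfold Ineq232Printed at h
  rw [sum_parts_star, card_W_star, star_Z₀] at h
  have h2 := two_d_le_treeLen_star (d := d)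
  have hd' : (3 : ℝ) ≤ d := by exact_mod_cast hd
  push_cast at h
  linarith

/-- The case d = 4 of the paper: for the star in ℤ⁴ the printed right side is 0 + 4·1 = 4 while d_k(Z₀) ≥ 8
(*"m = 2: claim d_k(Z₀) ≤ 4, truth ≥ 8"*, cell GAPS.md G-B13-08). [cite: Balaban1988RG2Cluster, (2.32) p.18] -/
theorem not_ineq232Printed_star_four : ¬ Ineq232Printed (star : CompData 4) (treeLen (d := 4)) :=
  not_ineq232Printed_star (by norm_num)

/-- The numbers of the d = 4 case: d_k(star) ≥ 8, Σ_i d_k(Y_i) = 0, M⁻⁴|Z₀∖Y₀| = 1. [folklore] -/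
theorem star_four_numbers :
    8 ≤ treeLen (Zstar (d := 4)) ∧ ∑ P ∈ (star : CompData 4).parts, treeLen P = 0 ∧
      (star : CompData 4).W.card = 1 := by
  refine ⟨?_, sum_parts_star, card_W_star⟩
  have h := two_d_le_treeLen_star (d := 4)
  norm_num at h
  exact h

/-- On the same datum the (2.32)-SUBSTITUTE `ineq232_treeLen` (constant 1 + 4d) holds, as it must:
d_k(star) ≤ 0 + (1 + 4d)·1. [cite: Balaban1988RG2Cluster, (2.32) p.18] -/
theorem treeLen_star_le (hd : 0 < d) : treeLen (Zstar (d := d)) ≤ 1 + 4 * (d : ℝ) := by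
  have hne : (star : CompData d).parts.Nonempty :=
    ⟨arm (⟨0, hd⟩, true), mem_arms.2 ⟨(⟨0, hd⟩, true), rfl⟩⟩
  have h := ineq232_treeLen (star : CompData d) hne
  rw [sum_parts_star, card_W_star, star_Z₀] at h
  push_cast at h
  linarith

/-- d = 4: 8 ≤ d_k(star) ≤ 17 — the printed bound 4 fails, the substitute bound 17 holds. [cite: Balaban1988RG2Cluster, (2.32) p.18] -/
theorem star_four_sandwich : 8 ≤ treeLen (Zstar (d := 4)) ∧ treeLen (Zstar (d := 4)) ≤ 17 := by
  refine ⟨star_four_numbers.1, ?_⟩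
  have h := treeLen_star_le (d := 4) (by norm_num)
  norm_num at h
  exact h

end Literature.MathematicalPhysics.QuantumFieldTheory.Balaban1983to89.B13Ineq232Star

end
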